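import Summits.AtomisticToContinuum.HydrodynamicLimit.Theses.SuperextensiveClosureCost

/-!
# Birth skeleton — crux `EnergyClosureCost` (stmt-AtomisticToContinuum-14426)

Route `SuperextensiveClosureCost` (AtomisticToContinuum / HydrodynamicLimit), crux rank 5:
`Summit.AtomisticToContinuum.HydrodynamicLimit.Theses.SuperextensiveClosureCost.EnergyClosureCost` —
under the invariant homogeneous hard-sphere Gibbs law `G_N = localGibbsLaw σ 1 0 θe N`, the event
"speed cap `(N+1)^{1/24}` and ball-packing cap `η₁` on `[s, s+τ]` AND time-integrated weak-form ENERGY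
closure defect `|D^E_N| > δ`" has `G_N`-probability `≤ exp (−M(N+1))` eventually, for every `M`.

## The line (kinetic / collisional split of the energy current — the route's foreseen two-layer plan
"EnergyClosureCost ⇐ JetChannelExclusion → HeatFluxNegligibility → glue", typed)

The weak-form defect of the crux is
`D^E_N = Et(s+τ)(φ(s+τ)) − Et(s)(φ(s)) − ∫_s^{s+τ} [Et(r)(∂_r φ) + ∫ (e + p)(m/ρ)·∇φ dx] dr`
(`Et` raw empirical kinetic energy, `(ρ, m, e)` ball averages at radius `ℓ_N = (N+1)^{-1/4}`,
`p = hsPressure σ ρ θ = ρ θ Z(ρσ³)`, `θ = ⅔(e/ρ − |m|²/(2ρ²))`). Along a hard-sphere orbit the raw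
energy functional changes by FREE STREAMING — at rate exactly the microscopic kinetic energy current
`K_N(r) = (N+1)⁻¹ Σ_i ½|v_i|² v_i·∇φ(r, q_i)` — and by COLLISIONAL TRANSFER across contacts (energy
`ΔE` jumps a distance `σ(N+1)^{-1/3}` at each of the `≍ σ²(N+1)^{4/3}` collisions per unit time: an
`O(σ³)` = excess-pressure-work contribution at fixed reduced density). Accordingly

* `kineticDefect = ∫_s^{s+τ} [K_N(r) − ∫ (e + ρθ)(m/ρ)·∇φ dx] dr` — microscopic kinetic energy
  current versus the IDEAL single-fluid enthalpy flux `(e + ρθ)u` of the block fields (third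
  velocity moment at local equilibrium: kinetic heat flux `q_kin = 0` at scales `≥ ℓ_N`, no
  anomalous convective transport by sub-block streams);
* `energyDefect − kineticDefect` — what free streaming does not carry: the collisional transfer of
  kinetic energy across contacts versus the EXCESS-pressure work `(p − ρθ)(m/ρ)·∇φ`,
  `p − ρθ = ρθ (Z(ρσ³) − 1)` (collisional heat flux `q_coll = 0`, local virial = equation of state).
  It is written with the two time integrals un-merged, so that `D = (D − D_kin) + D_kin` is an
  identity needing no integrability; under interval-integrability of the integrands along good
  orbits (piecewise-constant velocities, continuous positions) it equals
  `[transport − ∫ K_N] − ∫∫ (p − ρθ)(m/ρ)·∇φ`.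

`stub_kineticCurrentClosure` / `stub_collisionalTransferClosure`: each piece is superexponentially
small under the same two caps and the same `G_N` (same quantifier prefix as the crux).
`EnergyClosureCost_of`: thresholds `min η₁ η₂`, `min σ₁ σ₂`; both stubs at `δ/2` and `M+1`;
monotonicity of the packing-cap event in `η₁`; `|D| > δ ⇒ |D − D_kin| > δ/2 ∨ |D_kin| > δ/2`;
union bound; `2·e^{−(M+1)(N+1)} ≤ e^{−M(N+1)}`.

## Hardest stub, evidence honoured

`stub_kineticCurrentClosure` is the hardest and carries the crux's own why-might-fail (co-moving
sub-block jets / the cubic current). No `Disproof.lean` exists for this crux at registration (crux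
dir empty). The refuter's physics-level SUSPECT-FALSE witness (item evidence
`SUSPECT-FALSE-14424.md` §4 "ENERGY", 2026-08-16: drifting vacuum-gap needle beams, bimodal
velocity law, `D^E_N = V₂ p_Z τ` at `G`-cost `(2.3+o(1))N`) bites EXACTLY `stub_kineticCurrentClosure`
(on the beams `K_N` transports `e·V₂` while the single-fluid enthalpy flux is `(e + ρθ)V₂`; the
mismatch is the ideal pressure work `p_Z V₂`), and leaves `stub_collisionalTransferClosure` untouched
(free flight in the gap: transport `= ∫ K_N` exactly). The refuter's proposed repair C′ (a fourth-moment
cap `(N+1)⁻¹ Σ‖v_i‖⁴ ≤ K` inside the conditioning event) would enter the cap event of both stubs and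
leave the shape of `EnergyClosureCost_of` unchanged. Nothing in `ledger negatives` is an instance of
either stub (finite-instance Enskog families / cell dichotomies; these are `N → ∞` statements).

Sources: KipnisLandim1999 Ch. 10 Thm 3.1 (superexponential replacement, SSEP template);
Spohn1991 Part I Ch. 3 and (7.28); BertiniEtAl2015 (MFT cost rule); NachtergaeleYau2003.
-/

namespace Summit.AtomisticToContinuum.HydrodynamicLimit.Cruxes.EnergyClosureCost.Birth

open scoped BigOperators ENNReal
open MeasureTheory Filter Set
open Literature.MathematicalPhysics.KineticTheory

noncomputable section

/-- The hard-sphere flow type of the route: `N + 1` spheres of diameter `hsDiameter σ N` on `𝕋³`. -/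
abbrev Flow (σ : ℝ) (N : ℕ) :=
  Literature.Analysis.FluidPDE.HardSphereFlow (Literature.Analysis.FluidPDE.Torus.geometry (Fin 3))
    (hsDiameter σ N) (N + 1)

/-- The SPEED CAP of the crux's conditioning event: every speed `≤ (N+1)^{1/24}` on `[s, s+τ]`
(verbatim the first conjunct of the crux's event). -/
def SpeedCap (σ : ℝ) (N : ℕ) (Φ : Flow σ N) (s τ : ℝ)
    (z : Literature.Analysis.FluidPDE.Config (N + 1) (Fin 3) T3) : Prop :=
  ∀ r ∈ Set.Icc s (s + τ), ∀ i, ‖(Φ.flow r z i).2‖ ≤ ((N + 1 : ℕ) : ℝ) ^ (1 / 24 : ℝ)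

/-- The PACKING CAP of the crux's conditioning event: every ball of radius `ℓ_N = (N+1)^{-1/4}` has
empirical packing `ρ^{(ℓ)} σ³ ≤ η₁` on `[s, s+τ]` (verbatim the second conjunct, `let`s unfolded). -/
def PackingCap (σ η₁ : ℝ) (N : ℕ) (Φ : Flow σ N) (s τ : ℝ)
    (z : Literature.Analysis.FluidPDE.Config (N + 1) (Fin 3) T3) : Prop :=
  ∀ r ∈ Set.Icc s (s + τ), ∀ x : T3,
    empiricalDensityField (Φ.flow r z)
        (fun y => if Literature.Analysis.FluidPDE.Torus.euclidDist x y < ((N + 1 : ℕ) : ℝ) ^ (-(1 / 4 : ℝ))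
          then (4 / 3 * Real.pi * (((N + 1 : ℕ) : ℝ) ^ (-(1 / 4 : ℝ))) ^ 3)⁻¹ else 0) * σ ^ 3 ≤ η₁

/-- The crux's time-integrated weak-form ENERGY closure defect `D^E_N(z)` for the test function `φ`
on the window `[s, s+τ]` — verbatim the quantity inside `δ < |…|` of `EnergyClosureCost`. -/
def energyDefect (σ : ℝ) (N : ℕ) (Φ : Flow σ N) (s τ : ℝ) (φ : ℝ → T3 → ℝ)
    (z : Literature.Analysis.FluidPDE.Config (N + 1) (Fin 3) T3) : ℝ :=
  let ℓ : ℝ := ((N + 1 : ℕ) : ℝ) ^ (-(1 / 4 : ℝ))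
  let χ : T3 → T3 → ℝ := fun x y =>
    if Literature.Analysis.FluidPDE.Torus.euclidDist x y < ℓ then (4 / 3 * Real.pi * ℓ ^ 3)⁻¹ else 0
  let ρ : ℝ → T3 → ℝ := fun r x => empiricalDensityField (Φ.flow r z) (χ x)
  let m : ℝ → T3 → V3 := fun r x => empiricalMomentumField (Φ.flow r z) (χ x)
  let e : ℝ → T3 → ℝ := fun r x => empiricalEnergyField (Φ.flow r z) (χ x)
  let p : ℝ → T3 → ℝ := fun r x =>
    hsPressure σ (ρ r x) (2 / 3 * (e r x / ρ r x - ‖m r x‖ ^ 2 / (2 * ρ r x ^ 2)))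
  let Et : ℝ → (T3 → ℝ) → ℝ := fun r g => empiricalEnergyField (Φ.flow r z) g
  Et (s + τ) (φ (s + τ)) - Et s (φ s) -
    ∫ r in s..(s + τ),
      (Et r (Literature.Analysis.FunctionSpaces.Torus.timeDerivWithin (Set.Icc s (s + τ)) φ r) +
        ∫ x, (e r x + p r x) *
          (∑ i, (m r x i / ρ r x) * (Literature.Analysis.FunctionSpaces.Torus.gradient (φ r) x) i))

/-- The KINETIC closure defect `D^K_N(z) = ∫_s^{s+τ} [K_N(r) − F_kin(r)] dr`: the microscopic kinetic
energy current `K_N(r) = ∫ ½‖v‖² (v·∇φ(r,q)) dμ^{emp}_{Φ_r z}` (free-streaming rate of change of the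
raw energy functional) minus the IDEAL single-fluid enthalpy flux of the block fields
`F_kin(r) = ∫ (e + ρθ)(m/ρ)·∇φ dx`, `θ = ⅔(e/ρ − ‖m‖²/(2ρ²))` (so `ρθ` = ideal part of `hsPressure`). -/
def kineticDefect (σ : ℝ) (N : ℕ) (Φ : Flow σ N) (s τ : ℝ) (φ : ℝ → T3 → ℝ)
    (z : Literature.Analysis.FluidPDE.Config (N + 1) (Fin 3) T3) : ℝ :=
  let ℓ : ℝ := ((N + 1 : ℕ) : ℝ) ^ (-(1 / 4 : ℝ))
  let χ : T3 → T3 → ℝ := fun x y =>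
    if Literature.Analysis.FluidPDE.Torus.euclidDist x y < ℓ then (4 / 3 * Real.pi * ℓ ^ 3)⁻¹ else 0
  let ρ : ℝ → T3 → ℝ := fun r x => empiricalDensityField (Φ.flow r z) (χ x)
  let m : ℝ → T3 → V3 := fun r x => empiricalMomentumField (Φ.flow r z) (χ x)
  let e : ℝ → T3 → ℝ := fun r x => empiricalEnergyField (Φ.flow r z) (χ x)
  let K : ℝ → ℝ := fun r =>
    ∫ y, (‖y.2‖ ^ 2 / 2) * (∑ i, y.2 i * (Literature.Analysis.FunctionSpaces.Torus.gradient (φ r) y.1) i)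
      ∂(Literature.Analysis.FluidPDE.empiricalMeasure (Φ.flow r z))
  let Fkin : ℝ → ℝ := fun r =>
    ∫ x, (e r x + ρ r x * (2 / 3 * (e r x / ρ r x - ‖m r x‖ ^ 2 / (2 * ρ r x ^ 2)))) *
      (∑ i, (m r x i / ρ r x) * (Literature.Analysis.FunctionSpaces.Torus.gradient (φ r) x) i)
  ∫ r in s..(s + τ), (K r - Fkin r)

/-! ### Registered stubs -/

/-- **stub A — kinetic energy-current closure (hardest; the jets live here).** Under the invariant
homogeneous Gibbs law, for every smooth test `φ` on `[s, s+τ]`, `δ > 0` and EVERY `M`: eventually in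
`N`, `G_N {speed cap ∧ packing cap η₁ ∧ δ < |kineticDefect|} ≤ exp (−M(N+1))` — the time-integrated
difference between the microscopic kinetic energy current `½Σ‖v‖²v·∇φ` and the ideal enthalpy flux
`(e + ρθ)u·∇φ` of the ball-averaged fields is superexponentially rare under both caps (third velocity
moment at local equilibrium at scales `≥ ℓ_N`: kinetic heat flux and sub-block counter-streaming
both relax in `≪` Euler time; sustaining them should cost space-time volume × collision rate).
Why it might fail: the SUSPECT-FALSE needle-beam witness (item evidence, 2026-08-16) prices a
sustained bimodal sub-block velocity law at `O(N)` under both caps — as typed this stub inherits it. -/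
theorem stub_kineticCurrentClosure :
    ∃ η₁ : ℝ, 0 < η₁ ∧ ∃ σ₀ : ℝ, 0 < σ₀ ∧ ∀ σ : ℝ, 0 < σ → σ < σ₀ → ∀ θe : ℝ, 0 < θe →
      ∀ Φ : (N : ℕ) → Flow σ N, ∀ (s τ : ℝ), 0 ≤ s → 0 < τ → ∀ φ : ℝ → T3 → ℝ,
        Literature.Analysis.FunctionSpaces.Torus.IsSmoothSpaceTimeOn (Set.Icc s (s + τ)) φ →
          ∀ δ : ℝ, 0 < δ → ∀ M : ℝ, ∀ᶠ N : ℕ in Filter.atTop,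
            localGibbsLaw σ (fun _ => 1) (fun _ => 0) (fun _ => θe) N (Φ N)
                {z | SpeedCap σ N (Φ N) s τ z ∧ PackingCap σ η₁ N (Φ N) s τ z ∧
                  δ < |kineticDefect σ N (Φ N) s τ φ z|}
              ≤ ENNReal.ofReal (Real.exp (-(M * (N + 1)))) := by
  sorry

/-- **stub B — collisional-transfer closure.** Same law, caps, tests and rate for the REMAINDER
`energyDefect − kineticDefect`: the part of the raw-energy transport not carried by free streaming —
the collisional transfer of kinetic energy across contacts (jumps of `ΔE` over the contact vector
`σ(N+1)^{-1/3} n`) — against the excess-pressure work `(p − ρθ)(m/ρ)·∇φ`, `p − ρθ = ρθ(Z(ρσ³) − 1)`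
(`hsCompressibility`), is superexponentially rare: local virial = equation of state and collisional
heat flux `→ 0` at scales `≥ ℓ_N` (conductive flux `≍ N^{-1/12}`), sustained deviations costing
collision-count entropy `≍ N^{4/3}`. Stated with un-merged time integrals (no integrability needed
for `D = (D − D_kin) + D_kin`). Why it might fail: dense or ordered contact textures below the packing
cap biasing the transfer direction for `O(1)` times at `O(N)` cost; `Z(ρσ³)` enters through the
`limsup`/`deriv` definition of `hsExcessFreeEnergy` (virial identification hidden in the stub). -/
theorem stub_collisionalTransferClosure :
    ∃ η₁ : ℝ, 0 < η₁ ∧ ∃ σ₀ : ℝ, 0 < σ₀ ∧ ∀ σ : ℝ, 0 < σ → σ < σ₀ → ∀ θe : ℝ, 0 < θe →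
      ∀ Φ : (N : ℕ) → Flow σ N, ∀ (s τ : ℝ), 0 ≤ s → 0 < τ → ∀ φ : ℝ → T3 → ℝ,
        Literature.Analysis.FunctionSpaces.Torus.IsSmoothSpaceTimeOn (Set.Icc s (s + τ)) φ →
          ∀ δ : ℝ, 0 < δ → ∀ M : ℝ, ∀ᶠ N : ℕ in Filter.atTop,
            localGibbsLaw σ (fun _ => 1) (fun _ => 0) (fun _ => θe) N (Φ N)
                {z | SpeedCap σ N (Φ N) s τ z ∧ PackingCap σ η₁ N (Φ N) s τ z ∧
                  δ < |energyDefect σ N (Φ N) s τ φ z - kineticDefect σ N (Φ N) s τ φ z|}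
              ≤ ENNReal.ofReal (Real.exp (-(M * (N + 1)))) := by
  sorry

/-! ### Glue lemmas (sorry-free) -/

/-- The packing-cap event is monotone in the threshold. -/
theorem PackingCap.mono {σ η η' : ℝ} {N : ℕ} {Φ : Flow σ N} {s τ : ℝ}
    {z : Literature.Analysis.FluidPDE.Config (N + 1) (Fin 3) T3}
    (h : η ≤ η') (hp : PackingCap σ η N Φ s τ z) : PackingCap σ η' N Φ s τ z := by
  unfold PackingCap at hp ⊢
  intro r hr x
  exact (hp r hr x).trans h

/-- `δ < |D|` forces `δ/2 < |D − I|` or `δ/2 < |I|`. -/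
theorem abs_half_split (D I δ : ℝ) (h : δ < |D|) : δ / 2 < |D - I| ∨ δ / 2 < |I| := by
  by_cases hI : δ / 2 < |I|
  · exact Or.inr hI
  · left
    have hI' : |I| ≤ δ / 2 := not_lt.mp hI
    have h1 : |D| - |I| ≤ |D - I| := abs_sub_abs_le_abs_sub D I
    linarith

/-- The crux event (packing threshold `min η₁ η₂`) lies in the union of the two stub events at `δ/2`. -/
theorem defectEvent_subset_union (σ η₁ η₂ : ℝ) (N : ℕ) (Φ : Flow σ N) (s τ : ℝ)
    (φ : ℝ → T3 → ℝ) (δ : ℝ) :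
    {z | SpeedCap σ N Φ s τ z ∧ PackingCap σ (min η₁ η₂) N Φ s τ z ∧
        δ < |energyDefect σ N Φ s τ φ z|} ⊆
      {z | SpeedCap σ N Φ s τ z ∧ PackingCap σ η₂ N Φ s τ z ∧
          δ / 2 < |energyDefect σ N Φ s τ φ z - kineticDefect σ N Φ s τ φ z|} ∪
      {z | SpeedCap σ N Φ s τ z ∧ PackingCap σ η₁ N Φ s τ z ∧
          δ / 2 < |kineticDefect σ N Φ s τ φ z|} := by
  rintro z ⟨hv, hp, hd⟩
  rcases abs_half_split (energyDefect σ N Φ s τ φ z) (kineticDefect σ N Φ s τ φ z) δ hd with h | h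
  · exact Or.inl ⟨hv, hp.mono (min_le_right _ _), h⟩
  · exact Or.inr ⟨hv, hp.mono (min_le_left _ _), h⟩

/-- `2 ≤ exp (N + 1)`, i.e. `2 e^{-(N+1)} ≤ 1`. -/
theorem two_mul_exp_neg_le_one (N : ℕ) : 2 * Real.exp (-((N : ℝ) + 1)) ≤ 1 := by
  have hge : (2 : ℝ) ≤ Real.exp ((N : ℝ) + 1) := by
    have h := Real.add_one_le_exp ((N : ℝ) + 1)
    have hN : (0 : ℝ) ≤ N := Nat.cast_nonneg N
    linarith
  have hmul : Real.exp ((N : ℝ) + 1) * Real.exp (-((N : ℝ) + 1)) = 1 := by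
    rw [← Real.exp_add, add_neg_cancel, Real.exp_zero]
  have hpos : 0 < Real.exp (-((N : ℝ) + 1)) := Real.exp_pos _
  nlinarith

/-- The superexponential budget absorbs the union bound: `2 e^{-(M+1)(N+1)} ≤ e^{-M(N+1)}`. -/
theorem two_half_budget (M : ℝ) (N : ℕ) :
    ENNReal.ofReal (Real.exp (-((M + 1) * ((N : ℝ) + 1)))) +
        ENNReal.ofReal (Real.exp (-((M + 1) * ((N : ℝ) + 1)))) ≤
      ENNReal.ofReal (Real.exp (-(M * ((N : ℝ) + 1)))) := by
  have hA : 0 < Real.exp (-(M * ((N : ℝ) + 1))) := Real.exp_pos _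
  have hexp : Real.exp (-((M + 1) * ((N : ℝ) + 1))) =
      Real.exp (-(M * ((N : ℝ) + 1))) * Real.exp (-((N : ℝ) + 1)) := by
    rw [← Real.exp_add]
    congr 1
    ring
  have hreal : Real.exp (-((M + 1) * ((N : ℝ) + 1))) + Real.exp (-((M + 1) * ((N : ℝ) + 1))) ≤
      Real.exp (-(M * ((N : ℝ) + 1))) := by
    rw [hexp]
    calc Real.exp (-(M * ((N : ℝ) + 1))) * Real.exp (-((N : ℝ) + 1)) +
          Real.exp (-(M * ((N : ℝ) + 1))) * Real.exp (-((N : ℝ) + 1))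
        = Real.exp (-(M * ((N : ℝ) + 1))) * (2 * Real.exp (-((N : ℝ) + 1))) := by ring
      _ ≤ Real.exp (-(M * ((N : ℝ) + 1))) * 1 :=
          mul_le_mul_of_nonneg_left (two_mul_exp_neg_le_one N) hA.le
      _ = Real.exp (-(M * ((N : ℝ) + 1))) := mul_one _
  calc ENNReal.ofReal (Real.exp (-((M + 1) * ((N : ℝ) + 1)))) +
        ENNReal.ofReal (Real.exp (-((M + 1) * ((N : ℝ) + 1))))
      = ENNReal.ofReal (Real.exp (-((M + 1) * ((N : ℝ) + 1))) +
          Real.exp (-((M + 1) * ((N : ℝ) + 1)))) :=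
        (ENNReal.ofReal_add (Real.exp_pos _).le (Real.exp_pos _).le).symm
    _ ≤ ENNReal.ofReal (Real.exp (-(M * ((N : ℝ) + 1)))) := ENNReal.ofReal_le_ofReal hreal

/-! ### The assembly: the two stubs imply the crux BY NAME -/

/-- **Assembly (the skeleton theorem).** `EnergyClosureCost` — the route decl, BY NAME — from the two
DECLARED stubs `stub_kineticCurrentClosure` and `stub_collisionalTransferClosure` (the only `sorry`s of
the file; `ledger skeleton check` shape: no hypotheses, stubs consumed by name). The composition is
real: thresholds `min η₁ η₂`, `min σ₁ σ₂`; both stubs at `δ/2` and `M + 1`; monotonicity of the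
packing-cap event; `|D| > δ ⇒ |D − D_kin| > δ/2 ∨ |D_kin| > δ/2`; union bound;
`2 e^{-(M+1)(N+1)} ≤ e^{-M(N+1)}`. The crux's `let`-bound event is this file's
`SpeedCap ∧ PackingCap ∧ δ < |energyDefect|` by `δ/ζ`-unfolding (`change`). -/
theorem EnergyClosureCost_of :
    Summit.AtomisticToContinuum.HydrodynamicLimit.Theses.SuperextensiveClosureCost.EnergyClosureCost := by
  have hK := stub_kineticCurrentClosure
  have hC := stub_collisionalTransferClosure
  obtain ⟨η₁, hη₁, σ₁, hσ₁, H₁⟩ := hK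
  obtain ⟨η₂, hη₂, σ₂, hσ₂, H₂⟩ := hC
  refine ⟨min η₁ η₂, lt_min hη₁ hη₂, min σ₁ σ₂, lt_min hσ₁ hσ₂, ?_⟩
  intro σ hσ hσlt θe hθe Φ s τ hs hτ φ hφ δ hδ M
  have h₁ := H₁ σ hσ (lt_of_lt_of_le hσlt (min_le_left _ _)) θe hθe Φ s τ hs hτ φ hφ
    (δ / 2) (half_pos hδ) (M + 1)
  have h₂ := H₂ σ hσ (lt_of_lt_of_le hσlt (min_le_right _ _)) θe hθe Φ s τ hs hτ φ hφ
    (δ / 2) (half_pos hδ) (M + 1)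
  filter_upwards [h₁, h₂] with N hN₁ hN₂
  change localGibbsLaw σ (fun _ => 1) (fun _ => 0) (fun _ => θe) N (Φ N)
      {z | SpeedCap σ N (Φ N) s τ z ∧ PackingCap σ (min η₁ η₂) N (Φ N) s τ z ∧
        δ < |energyDefect σ N (Φ N) s τ φ z|} ≤ ENNReal.ofReal (Real.exp (-(M * (N + 1))))
  calc localGibbsLaw σ (fun _ => 1) (fun _ => 0) (fun _ => θe) N (Φ N)
        {z | SpeedCap σ N (Φ N) s τ z ∧ PackingCap σ (min η₁ η₂) N (Φ N) s τ z ∧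
          δ < |energyDefect σ N (Φ N) s τ φ z|}
      ≤ localGibbsLaw σ (fun _ => 1) (fun _ => 0) (fun _ => θe) N (Φ N)
          ({z | SpeedCap σ N (Φ N) s τ z ∧ PackingCap σ η₂ N (Φ N) s τ z ∧
              δ / 2 < |energyDefect σ N (Φ N) s τ φ z - kineticDefect σ N (Φ N) s τ φ z|} ∪
            {z | SpeedCap σ N (Φ N) s τ z ∧ PackingCap σ η₁ N (Φ N) s τ z ∧
              δ / 2 < |kineticDefect σ N (Φ N) s τ φ z|}) :=
        measure_mono (defectEvent_subset_union σ η₁ η₂ N (Φ N) s τ φ δ)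
    _ ≤ localGibbsLaw σ (fun _ => 1) (fun _ => 0) (fun _ => θe) N (Φ N)
            {z | SpeedCap σ N (Φ N) s τ z ∧ PackingCap σ η₂ N (Φ N) s τ z ∧
              δ / 2 < |energyDefect σ N (Φ N) s τ φ z - kineticDefect σ N (Φ N) s τ φ z|} +
          localGibbsLaw σ (fun _ => 1) (fun _ => 0) (fun _ => θe) N (Φ N)
            {z | SpeedCap σ N (Φ N) s τ z ∧ PackingCap σ η₁ N (Φ N) s τ z ∧
              δ / 2 < |kineticDefect σ N (Φ N) s τ φ z|} :=
        measure_union_le _ _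
    _ ≤ ENNReal.ofReal (Real.exp (-((M + 1) * ((N : ℝ) + 1)))) +
          ENNReal.ofReal (Real.exp (-((M + 1) * ((N : ℝ) + 1)))) := add_le_add hN₂ hN₁
    _ ≤ ENNReal.ofReal (Real.exp (-(M * ((N : ℝ) + 1)))) := two_half_budget M N

end

end Summit.AtomisticToContinuum.HydrodynamicLimit.Cruxes.EnergyClosureCost.Birth
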